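import Mathlib
import Literature.MathematicalPhysics.QuantumFieldTheory.Balaban1983to89.B8Lemma1NonAbelian
import Summits.QuantumFields.BalabanUV.T4Continuum.Support.NE3CovariantLineAdjoint
import HarnessLib

/-!
# NE3 support, route (H♮) row K4-0 file 2: comb words versus tree words — the flat word moves in the small-field class

OWNER's row K4-0 (journal SHAPE K4 l.17848; this lineage's CLAIM l.18532, located convention point C-ne3leaf04g5-2 l.18557,
SHAPE l.18587): the single-scale κ-last COMB line sum `TWc` (leaf-03's `NE3CovariantLineAdjointFrame`) versus the NESTED straight
tower `Ad (cavgIter L k W z κ) (QstrIter L k W η z κ)` (this lineage).  File 1 (`NE3CombVsTowerLineSums`) made the comparison exact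
bookkeeping: both read every fine copy through a unitary transport to the corner; they differ only in the PATH.  This file is the
word surgery, in the small-field class `SmallField W a` (every plaquette variable (44) within `a` of `1`):

§0 bookkeeping (`norm_hol_le_one`; `norm_hol_append3_sub_le` — a common prefix and a common-displacement suffix do not change the
   distance; `tw`∕`seg`∕coordinate lemmas);
§1 THE PLAQUETTE MOVE `‖W[μ,ν] − W[ν,μ]‖ ≤ a` (`norm_hol_swap_le`), a column `‖W(m•μ ++ ν) − W(ν ++ m•μ)‖ ≤ m·a`
   (`norm_hol_replicate_step_comm_le`), a segment through a forward word avoiding its direction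
   `‖W(m•μ ++ w) − W(w ++ m•μ)‖ ≤ m·|w|·a` (`norm_hol_replicate_word_comm_le`) — ribbons of plaquette moves;
§2 THE WORD SURGERIES of the K4-0 recursion: tree·segment versus the κ-last comb word
   `‖W(Γ_v ++ seg_κ i) − W(klastWord κ v i)‖ ≤ |v|₁²·a` (`norm_hol_treeWord_seg_sub_klast_le`), merging two tree words
   `‖W(tw u ++ tw w) − W(tw (u+w))‖ ≤ |tw u|·|tw w|·a` (`norm_hol_tw_append_sub_le`), merging two consecutive comb words
   `‖W(klast V I)·W(klast v i) − W(klast (V+v) (I+i))‖ ≤ ((|V|₁+I)|v|₁ + |V|₁|v|₁)·a` (`norm_hol_klast_mul_klast_sub_le`).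
File 3 (`NE3CombVsTowerStraighten`) adds the one-level straightening of averaged bonds and assembles the one-step path mismatch.
HONEST: elementary lattice gauge kinematics on OUR definitions ((9), (44) of [Balaban1985Averaging] are the only cited formulas);
(P♮)_W, (ML_w) at W ≠ 1, T-E_w, NE3 are NOT proved here; spine 0∕9; finite T⁴ rung (B)+1 — NOT infinite volume ∕ mass gap ∕
BetaPertH ∕ Clay.  PLACEMENT: `Summits/QuantumFields/BalabanUV/` (cell rule).
-/

set_option autoImplicit false

open scoped BigOperators Matrix.Norms.L2Operator
open Finset

namespace Summit.QuantumFields.BalabanUV.T4Continuum.NE3CombVsTowerPaths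

open Literature.MathematicalPhysics.QuantumFieldTheory.Balaban1983to89
open B7Prop1Explicit B7Prop2Explicit
open B8Lemma1NonAbelian (tw tw_nil tw_cons tw_congr treeWord_eq_tw forward_of_mem_treeWord ne_zero_of_mem_treeWord zsmul_e_apply)
open T4AveragingDeficitWall (IsUnitaryCfg SmallField val_hol_plaqWord)
open AveragingDeficitTransport (mem_U1_of_unitary)
open NE3CovariantLineAdjoint (klastWord disp_klastWord)

noncomputable section

variable {d : ℕ} {n : Type*} [Fintype n] [DecidableEq n]

/-! ## §0 Bookkeeping -/

/-- Every parallel transport of a unitary configuration has norm `≤ 1`. [folklore] -/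
theorem norm_hol_le_one [Nonempty n] {W : Site d → Fin d → (Matrix n n ℂ)ˣ} (hW : IsUnitaryCfg W) (x : Site d) (w : List (Letter d)) :
    ‖((hol W x w : (Matrix n n ℂ)ˣ) : Matrix n n ℂ)‖ ≤ 1 :=
  (mem_U1_of_unitary (hol_mem_of (S := unitaryUnits (Matrix n n ℂ)) (fun y μ => hW y μ) x w)).1

/-- A COMMON PREFIX AND A COMMON-DISPLACEMENT SUFFIX DO NOT CHANGE THE DISTANCE:
`‖W(A ++ X ++ S) − W(A ++ Y ++ S)‖ ≤ ‖W(X) − W(Y)‖` (spelled from `x + disp A`) when `disp X = disp Y`. [folklore] -/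
theorem norm_hol_append3_sub_le [Nonempty n] {W : Site d → Fin d → (Matrix n n ℂ)ˣ} (hW : IsUnitaryCfg W) (x : Site d)
    (A X Y S : List (Letter d)) (hXY : disp X = disp Y) :
    ‖((hol W x (A ++ X ++ S) : (Matrix n n ℂ)ˣ) : Matrix n n ℂ) - ((hol W x (A ++ Y ++ S) : (Matrix n n ℂ)ˣ) : Matrix n n ℂ)‖
      ≤ ‖((hol W (x + disp A) X : (Matrix n n ℂ)ˣ) : Matrix n n ℂ) - ((hol W (x + disp A) Y : (Matrix n n ℂ)ˣ) : Matrix n n ℂ)‖ := by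
  rw [hol_append, hol_append, hol_append, hol_append, disp_append, disp_append, hXY]
  simp only [Units.val_mul]
  rw [← sub_mul, ← mul_sub]
  calc _ ≤ ‖((hol W x A : (Matrix n n ℂ)ˣ) : Matrix n n ℂ)‖
          * ‖((hol W (x + disp A) X : (Matrix n n ℂ)ˣ) : Matrix n n ℂ) - ((hol W (x + disp A) Y : (Matrix n n ℂ)ˣ) : Matrix n n ℂ)‖
          * ‖((hol W (x + (disp A + disp Y)) S : (Matrix n n ℂ)ˣ) : Matrix n n ℂ)‖ :=
        (norm_mul_le _ _).trans (mul_le_mul_of_nonneg_right (norm_mul_le _ _) (norm_nonneg _))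
    _ ≤ 1 * ‖((hol W (x + disp A) X : (Matrix n n ℂ)ˣ) : Matrix n n ℂ) - ((hol W (x + disp A) Y : (Matrix n n ℂ)ˣ) : Matrix n n ℂ)‖ * 1 := by
        gcongr
        · exact norm_hol_le_one hW _ _
        · exact norm_hol_le_one hW _ _
    _ = _ := by ring

/-- `seg κ (p + q) = seg κ p ++ seg κ q` for naturals. [folklore] -/
theorem seg_natCast_add (κ : Fin d) (p q : ℕ) : seg κ ((p : ℤ) + (q : ℤ)) = seg κ (p : ℤ) ++ seg κ (q : ℤ) := by
  rw [← Nat.cast_add, seg_natCast, seg_natCast, seg_natCast, List.replicate_add]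

/-- Letters of `tw ks v` (`v ≥ 0`) are forward steps in directions listed in `ks`. [folklore] -/
theorem mem_tw {ks : List (Fin d)} {v : Site d} (hv : 0 ≤ v) {l : Letter d} (hl : l ∈ tw ks v) : l.2 = true ∧ l.1 ∈ ks := by
  simp only [tw, List.mem_flatMap] at hl
  obtain ⟨κ, hκ, hlκ⟩ := hl
  obtain ⟨m, hm⟩ := Int.eq_ofNat_of_zero_le (hv κ)
  rw [hm, seg_natCast, List.mem_replicate] at hlκ
  rw [hlκ.2]
  exact ⟨rfl, hκ⟩

/-- `tw (ks ++ ks') v = tw ks v ++ tw ks' v`. [folklore] -/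
theorem tw_append (ks ks' : List (Fin d)) (v : Site d) : tw (ks ++ ks') v = tw ks v ++ tw ks' v := by
  simp [tw, List.flatMap_append]

/-- `disp (tw ks v)` does not depend on the order of the moves: `disp (tw ks u ++ tw ks w) = disp (tw ks (u + w))`. [folklore] -/
theorem disp_tw_add (ks : List (Fin d)) (u w : Site d) : disp (tw ks (u + w)) = disp (tw ks u) + disp (tw ks w) := by
  induction ks with
  | nil => simp
  | cons κ ks ih =>
      simp only [tw_cons, disp_append, disp_seg, Pi.add_apply, add_smul, ih]
      abel

/-- Zeroing the `κ`-coordinate: `(v − v_κ e_κ)_ι = if ι = κ then 0 else v_ι`. [folklore] -/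
theorem sub_coord_apply (v : Site d) (κ ι : Fin d) : (v - v κ • e κ) ι = if ι = κ then 0 else v ι := by
  simp only [Pi.sub_apply, zsmul_e_apply]
  split_ifs with h <;> simp [h]

/-- Zeroing a coordinate of a non-negative vector keeps it non-negative. [folklore] -/
theorem sub_coord_nonneg {v : Site d} (hv : 0 ≤ v) (κ : Fin d) : 0 ≤ v - v κ • e κ := fun ι => by
  show (0 : ℤ) ≤ (v - v κ • e κ) ι
  rw [sub_coord_apply]; split_ifs; exacts [le_rfl, hv ι]

/-- `|v − v_κ e_κ|₁ + |v_κ| = |v|₁`. [folklore] -/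
theorem l1_sub_coord (v : Site d) (κ : Fin d) : l1 (v - v κ • e κ) + (v κ).natAbs = l1 v := by
  unfold l1
  rw [← Finset.add_sum_erase _ _ (Finset.mem_univ κ),
    ← Finset.add_sum_erase _ (fun ι => (v ι).natAbs) (Finset.mem_univ κ)]
  have h1 : ((v - v κ • e κ) κ).natAbs = 0 := by rw [sub_coord_apply, if_pos rfl, Int.natAbs_zero]
  have h2 : ∀ ι ∈ Finset.univ.erase κ, ((v - v κ • e κ) ι).natAbs = (v ι).natAbs := fun ι hι => by
    rw [sub_coord_apply, if_neg (Finset.ne_of_mem_erase hι)]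
  rw [h1, Finset.sum_congr rfl h2]
  ring

/-! ## §1 The plaquette move and its iterates -/

section Flat

variable [Nonempty n] {W : Site d → Fin d → (Matrix n n ℂ)ˣ} (hW : IsUnitaryCfg W) {a : ℝ} (ha : 0 ≤ a) (hWa : SmallField W a)

include hW ha hWa

omit ha in
/-- **THE PLAQUETTE MOVE**: `‖W(x,μ)W(x+e_μ,ν) − W(x,ν)W(x+e_ν,μ)‖ ≤ x`-smallness `a` — the two sides differ by the plaquette
variable (44), a unitary within `a` of `1`. [cite: Balaban1985Averaging, (44) p.24] -/
theorem norm_hol_swap_le (x : Site d) {μ ν : Fin d} (hμν : μ ≠ ν) :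
    ‖((hol W x [(μ, true), (ν, true)] : (Matrix n n ℂ)ˣ) : Matrix n n ℂ)
        - ((hol W x [(ν, true), (μ, true)] : (Matrix n n ℂ)ˣ) : Matrix n n ℂ)‖ ≤ a := by
  have h2 : ((hol W x [(μ, true), (ν, true)] : (Matrix n n ℂ)ˣ) : Matrix n n ℂ) = (W x μ : Matrix n n ℂ) * (W (x + e μ) ν : Matrix n n ℂ) := by
    simp only [hol_cons, hol_nil, stepHol_true, Letter.vec_true, mul_one, Units.val_mul]
  have h3 : ((hol W x [(ν, true), (μ, true)] : (Matrix n n ℂ)ˣ) : Matrix n n ℂ) = (W x ν : Matrix n n ℂ) * (W (x + e ν) μ : Matrix n n ℂ) := by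
    simp only [hol_cons, hol_nil, stepHol_true, Letter.vec_true, mul_one, Units.val_mul]
  have hkey : ((hol W x [(μ, true), (ν, true)] : (Matrix n n ℂ)ˣ) : Matrix n n ℂ)
      = ((hol W x (plaqWord μ ν) : (Matrix n n ℂ)ˣ) : Matrix n n ℂ) * ((hol W x [(ν, true), (μ, true)] : (Matrix n n ℂ)ˣ) : Matrix n n ℂ) := by
    rw [h2, h3, val_hol_plaqWord]
    simp only [← mul_assoc]
    rw [Units.inv_mul_cancel_right, Units.inv_mul_cancel_right]
  have hP : ‖((hol W x (plaqWord μ ν) : (Matrix n n ℂ)ˣ) : Matrix n n ℂ) - 1‖ ≤ a := hWa x μ ν hμν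
  rw [hkey, ← sub_one_mul]
  calc _ ≤ ‖((hol W x (plaqWord μ ν) : (Matrix n n ℂ)ˣ) : Matrix n n ℂ) - 1‖ * ‖((hol W x [(ν, true), (μ, true)] : (Matrix n n ℂ)ˣ) : Matrix n n ℂ)‖ :=
        norm_mul_le _ _
    _ ≤ a * 1 := mul_le_mul hP (norm_hol_le_one hW _ _) (norm_nonneg _) ((norm_nonneg _).trans hP)
    _ = a := mul_one a

/-- A COLUMN OF PLAQUETTE MOVES: `‖W(m•e_μ ++ e_ν) − W(e_ν ++ m•e_μ)‖ ≤ m·a`. [folklore] -/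
theorem norm_hol_replicate_step_comm_le {μ ν : Fin d} (hμν : μ ≠ ν) : ∀ (m : ℕ) (x : Site d),
    ‖((hol W x (List.replicate m (μ, true) ++ [(ν, true)]) : (Matrix n n ℂ)ˣ) : Matrix n n ℂ)
        - ((hol W x ((ν, true) :: List.replicate m (μ, true)) : (Matrix n n ℂ)ˣ) : Matrix n n ℂ)‖ ≤ (m : ℝ) * a := by
  intro m
  induction m with
  | zero => intro x; simp
  | succ m ih =>
      intro x
      -- `W(x,μ)·W((m•μ ++ ν) from x+e_μ) ≈ W(x,μ)·W(x+e_μ,ν)·W(m•μ from x+e_μ+e_ν) ≈ W(x,ν)W(x+e_ν,μ)·W(m•μ …)`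
      have hA : ((hol W x (List.replicate (m + 1) (μ, true) ++ [(ν, true)]) : (Matrix n n ℂ)ˣ) : Matrix n n ℂ)
          = (W x μ : Matrix n n ℂ) * ((hol W (x + e μ) (List.replicate m (μ, true) ++ [(ν, true)]) : (Matrix n n ℂ)ˣ) : Matrix n n ℂ) := by
        rw [List.replicate_succ, List.cons_append, hol_cons, stepHol_true, Letter.vec_true, Units.val_mul]
      have hB : (W x μ : Matrix n n ℂ) * ((hol W (x + e μ) ((ν, true) :: List.replicate m (μ, true)) : (Matrix n n ℂ)ˣ) : Matrix n n ℂ)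
          = ((hol W x [(μ, true), (ν, true)] : (Matrix n n ℂ)ˣ) : Matrix n n ℂ)
            * ((hol W (x + e μ + e ν) (List.replicate m (μ, true)) : (Matrix n n ℂ)ˣ) : Matrix n n ℂ) := by
        simp only [hol_cons, hol_nil, stepHol_true, Letter.vec_true, mul_one, Units.val_mul, mul_assoc]
      have hC : ((hol W x [(ν, true), (μ, true)] : (Matrix n n ℂ)ˣ) : Matrix n n ℂ)
            * ((hol W (x + e μ + e ν) (List.replicate m (μ, true)) : (Matrix n n ℂ)ˣ) : Matrix n n ℂ)
          = ((hol W x ((ν, true) :: List.replicate (m + 1) (μ, true)) : (Matrix n n ℂ)ˣ) : Matrix n n ℂ) := by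
        simp only [hol_cons, hol_nil, stepHol_true, Letter.vec_true, mul_one, Units.val_mul, mul_assoc, List.replicate_succ,
          add_right_comm x (e μ) (e ν)]
      rw [hA, ← hC]
      have h1 : ‖(W x μ : Matrix n n ℂ) * ((hol W (x + e μ) (List.replicate m (μ, true) ++ [(ν, true)]) : (Matrix n n ℂ)ˣ) : Matrix n n ℂ)
            - (W x μ : Matrix n n ℂ) * ((hol W (x + e μ) ((ν, true) :: List.replicate m (μ, true)) : (Matrix n n ℂ)ˣ) : Matrix n n ℂ)‖
          ≤ (m : ℝ) * a := by
        rw [← mul_sub]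
        calc _ ≤ ‖(W x μ : Matrix n n ℂ)‖ * ‖((hol W (x + e μ) (List.replicate m (μ, true) ++ [(ν, true)]) : (Matrix n n ℂ)ˣ) : Matrix n n ℂ)
                - ((hol W (x + e μ) ((ν, true) :: List.replicate m (μ, true)) : (Matrix n n ℂ)ˣ) : Matrix n n ℂ)‖ := norm_mul_le _ _
          _ ≤ 1 * ((m : ℝ) * a) :=
              mul_le_mul (mem_U1_of_unitary (hW x μ)).1 (ih (x + e μ)) (norm_nonneg _) zero_le_one
          _ = (m : ℝ) * a := one_mul _
      have h2 : ‖((hol W x [(μ, true), (ν, true)] : (Matrix n n ℂ)ˣ) : Matrix n n ℂ)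
              * ((hol W (x + e μ + e ν) (List.replicate m (μ, true)) : (Matrix n n ℂ)ˣ) : Matrix n n ℂ)
            - ((hol W x [(ν, true), (μ, true)] : (Matrix n n ℂ)ˣ) : Matrix n n ℂ)
              * ((hol W (x + e μ + e ν) (List.replicate m (μ, true)) : (Matrix n n ℂ)ˣ) : Matrix n n ℂ)‖ ≤ a := by
        rw [← sub_mul]
        calc _ ≤ ‖((hol W x [(μ, true), (ν, true)] : (Matrix n n ℂ)ˣ) : Matrix n n ℂ)
                - ((hol W x [(ν, true), (μ, true)] : (Matrix n n ℂ)ˣ) : Matrix n n ℂ)‖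
                * ‖((hol W (x + e μ + e ν) (List.replicate m (μ, true)) : (Matrix n n ℂ)ˣ) : Matrix n n ℂ)‖ := norm_mul_le _ _
          _ ≤ a * 1 := mul_le_mul (norm_hol_swap_le hW hWa x hμν) (norm_hol_le_one hW _ _) (norm_nonneg _) ha
          _ = a := mul_one a
      have h2' : ‖(W x μ : Matrix n n ℂ) * ((hol W (x + e μ) ((ν, true) :: List.replicate m (μ, true)) : (Matrix n n ℂ)ˣ) : Matrix n n ℂ)
            - ((hol W x [(ν, true), (μ, true)] : (Matrix n n ℂ)ˣ) : Matrix n n ℂ)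
              * ((hol W (x + e μ + e ν) (List.replicate m (μ, true)) : (Matrix n n ℂ)ˣ) : Matrix n n ℂ)‖ ≤ a := by
        rw [hB]; exact h2
      calc _ ≤ _ + _ := norm_sub_le_norm_sub_add_norm_sub _ ((W x μ : Matrix n n ℂ)
              * ((hol W (x + e μ) ((ν, true) :: List.replicate m (μ, true)) : (Matrix n n ℂ)ˣ) : Matrix n n ℂ)) _
        _ ≤ (m : ℝ) * a + a := add_le_add h1 h2'
        _ = ((m + 1 : ℕ) : ℝ) * a := by push_cast; ring

/-- A SEGMENT THROUGH A FORWARD WORD AVOIDING ITS DIRECTION: `‖W(m•e_μ ++ w) − W(w ++ m•e_μ)‖ ≤ m·|w|·a` when every letter of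
`w` is a forward step in a direction `≠ μ` (a ribbon of `m·|w|` plaquettes). [folklore] -/
theorem norm_hol_replicate_word_comm_le {μ : Fin d} : ∀ (w : List (Letter d)), (∀ l ∈ w, l.2 = true ∧ l.1 ≠ μ) →
    ∀ (m : ℕ) (x : Site d),
    ‖((hol W x (List.replicate m (μ, true) ++ w) : (Matrix n n ℂ)ˣ) : Matrix n n ℂ)
        - ((hol W x (w ++ List.replicate m (μ, true)) : (Matrix n n ℂ)ˣ) : Matrix n n ℂ)‖ ≤ (m : ℝ) * (w.length : ℝ) * a := by
  intro w
  induction w with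
  | nil => intro _ m x; simp
  | cons l w ih =>
      intro hw m x
      obtain ⟨hl2, hl1⟩ := hw l (by simp)
      have hw' : ∀ l' ∈ w, l'.2 = true ∧ l'.1 ≠ μ := fun l' hl' => hw l' (List.mem_cons_of_mem l hl')
      obtain ⟨ν, b⟩ := l
      simp only at hl2 hl1
      subst hl2
      -- step 1: the column move on the prefix `m•μ ++ [ν]`, common suffix `w`
      have hs1 : ‖((hol W x (List.replicate m (μ, true) ++ (ν, true) :: w) : (Matrix n n ℂ)ˣ) : Matrix n n ℂ)
            - ((hol W x (((ν, true) :: List.replicate m (μ, true)) ++ w) : (Matrix n n ℂ)ˣ) : Matrix n n ℂ)‖ ≤ (m : ℝ) * a := by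
        have h := norm_hol_append3_sub_le hW x [] (List.replicate m (μ, true) ++ [(ν, true)]) ((ν, true) :: List.replicate m (μ, true)) w
          (by simp [disp_replicate]; abel)
        simp only [List.nil_append, List.append_assoc, List.singleton_append, disp_nil, add_zero] at h
        exact h.trans (norm_hol_replicate_step_comm_le hW ha hWa hl1.symm m x)
      -- step 2: the induction hypothesis behind the first letter `ν`
      have hs2 : ‖((hol W x (((ν, true) :: List.replicate m (μ, true)) ++ w) : (Matrix n n ℂ)ˣ) : Matrix n n ℂ)
            - ((hol W x ((ν, true) :: w ++ List.replicate m (μ, true)) : (Matrix n n ℂ)ˣ) : Matrix n n ℂ)‖ ≤ (m : ℝ) * (w.length : ℝ) * a := by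
        rw [List.cons_append, hol_cons, List.cons_append, hol_cons, stepHol_true, Letter.vec_true, Units.val_mul, Units.val_mul, ← mul_sub]
        calc _ ≤ ‖(W x ν : Matrix n n ℂ)‖ * ‖((hol W (x + e ν) (List.replicate m (μ, true) ++ w) : (Matrix n n ℂ)ˣ) : Matrix n n ℂ)
                - ((hol W (x + e ν) (w ++ List.replicate m (μ, true)) : (Matrix n n ℂ)ˣ) : Matrix n n ℂ)‖ := norm_mul_le _ _
          _ ≤ 1 * ((m : ℝ) * (w.length : ℝ) * a) := mul_le_mul (mem_U1_of_unitary (hW x ν)).1 (ih hw' m (x + e ν)) (norm_nonneg _) zero_le_one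
          _ = _ := one_mul _
      calc _ ≤ _ + _ := norm_sub_le_norm_sub_add_norm_sub _ ((hol W x (((ν, true) :: List.replicate m (μ, true)) ++ w) : (Matrix n n ℂ)ˣ) : Matrix n n ℂ) _
        _ ≤ (m : ℝ) * a + (m : ℝ) * (w.length : ℝ) * a := add_le_add hs1 hs2
        _ = (m : ℝ) * (((ν, true) :: w).length : ℝ) * a := by rw [List.length_cons]; push_cast; ring

/-! ## §2 The two word surgeries -/

/-- **TREE·SEGMENT VERSUS THE κ-LAST COMB WORD**: for `v ≥ 0`, `‖W(Γ_v ++ seg_κ i) − W(klastWord κ v i)‖ ≤ |v|₁²·a` — the tree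
word does its `κ`-run in the middle (directions `d−1, …, 0`), the comb word does it last; they differ by a ribbon of
`v_κ · Σ_{κ'<κ} v_{κ'}` plaquettes. [folklore] -/
theorem norm_hol_treeWord_seg_sub_klast_le (x : Site d) (κ : Fin d) {v : Site d} (hv : 0 ≤ v) (i : ℕ) :
    ‖((hol W x (treeWord v ++ seg κ (i : ℤ)) : (Matrix n n ℂ)ˣ) : Matrix n n ℂ)
        - ((hol W x (klastWord κ v i) : (Matrix n n ℂ)ˣ) : Matrix n n ℂ)‖ ≤ (l1 v : ℝ) * (l1 v : ℝ) * a := by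
  obtain ⟨s, t, hst⟩ := List.append_of_mem (a := κ) (l := (List.finRange d).reverse) (by simp)
  have hnd : (s ++ κ :: t).Nodup := hst ▸ List.nodup_reverse.mpr (List.nodup_finRange d)
  rw [List.nodup_append] at hnd
  obtain ⟨-, hκt, hdisj⟩ := hnd
  have hκs : κ ∉ s := fun h => hdisj κ h κ List.mem_cons_self rfl
  have hκt' : κ ∉ t := (List.nodup_cons.mp hκt).1
  obtain ⟨m, hm⟩ := Int.eq_ofNat_of_zero_le (hv κ)
  set v' : Site d := v - v κ • e κ with hv'
  have hv'ap : ∀ ι, v' ι = if ι = κ then 0 else v ι := sub_coord_apply v κ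
  have hv'0 : 0 ≤ v' := sub_coord_nonneg hv κ
  have hts : tw s v' = tw s v := tw_congr fun ι hι => by rw [hv'ap, if_neg (fun h : ι = κ => hκs (h ▸ hι))]
  have htt : tw t v' = tw t v := tw_congr fun ι hι => by rw [hv'ap, if_neg (fun h : ι = κ => hκt' (h ▸ hι))]
  have hT : treeWord v = tw s v ++ (seg κ (m : ℤ) ++ tw t v) := by
    rw [treeWord_eq_tw, hst, tw_append, tw_cons, hm]
  have hT' : treeWord v' = tw s v ++ tw t v := by
    rw [treeWord_eq_tw, hst, tw_append, tw_cons, hts, htt, hv'ap, if_pos rfl, seg_zero, List.nil_append]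
  have hK : klastWord κ v i = tw s v ++ (tw t v ++ seg κ (m : ℤ)) ++ seg κ (i : ℤ) := by
    rw [klastWord, ← hv', hT', hm, seg_natCast_add, List.append_assoc, List.append_assoc, List.append_assoc]
  have hL : treeWord v ++ seg κ (i : ℤ) = tw s v ++ (seg κ (m : ℤ) ++ tw t v) ++ seg κ (i : ℤ) := by rw [hT, List.append_assoc]
  rw [hL, hK]
  have hw : ∀ l ∈ tw t v, l.2 = true ∧ l.1 ≠ κ := fun l hl =>
    ⟨(mem_tw hv hl).1, fun h => hκt' (h ▸ (mem_tw hv hl).2)⟩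
  have hlen_t : (tw t v).length ≤ l1 v := by
    have := congrArg List.length hT
    rw [length_treeWord, List.length_append, List.length_append] at this
    omega
  have hm_le : m ≤ l1 v := by
    have := congrArg List.length hT
    rw [length_treeWord, List.length_append, List.length_append, length_seg, Int.natAbs_natCast] at this
    omega
  calc _ ≤ ‖((hol W (x + disp (tw s v)) (seg κ (m : ℤ) ++ tw t v) : (Matrix n n ℂ)ˣ) : Matrix n n ℂ)
          - ((hol W (x + disp (tw s v)) (tw t v ++ seg κ (m : ℤ)) : (Matrix n n ℂ)ˣ) : Matrix n n ℂ)‖ :=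
        norm_hol_append3_sub_le hW x _ _ _ _ (by simp only [disp_append]; abel)
    _ ≤ (m : ℝ) * ((tw t v).length : ℝ) * a := by
        rw [seg_natCast]; exact norm_hol_replicate_word_comm_le hW ha hWa (tw t v) hw m _
    _ ≤ (l1 v : ℝ) * (l1 v : ℝ) * a := by gcongr

/-- **MERGING TWO TREE WORDS**: for `u, w ≥ 0` and a duplicate-free list of directions,
`‖W(tw ks u ++ tw ks w) − W(tw ks (u + w))‖ ≤ |tw ks u|·|tw ks w|·a`. [folklore] -/
theorem norm_hol_tw_append_sub_le : ∀ (ks : List (Fin d)), ks.Nodup → ∀ {u w : Site d}, 0 ≤ u → 0 ≤ w → ∀ (x : Site d),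
    ‖((hol W x (tw ks u ++ tw ks w) : (Matrix n n ℂ)ˣ) : Matrix n n ℂ)
        - ((hol W x (tw ks (u + w)) : (Matrix n n ℂ)ˣ) : Matrix n n ℂ)‖ ≤ ((tw ks u).length : ℝ) * ((tw ks w).length : ℝ) * a := by
  intro ks
  induction ks with
  | nil => intro _ u w _ _ x; simp
  | cons κ ks ih =>
      intro hnd u w hu hw x
      rw [List.nodup_cons] at hnd
      obtain ⟨hκ, hnd'⟩ := hnd
      obtain ⟨p, hp⟩ := Int.eq_ofNat_of_zero_le (hu κ)
      obtain ⟨q, hq⟩ := Int.eq_ofNat_of_zero_le (hw κ)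
      have hword : ∀ l ∈ tw ks u, l.2 = true ∧ l.1 ≠ κ := fun l hl =>
        ⟨(mem_tw hu hl).1, fun h => hκ (h ▸ (mem_tw hu hl).2)⟩
      -- the words
      have h1 : tw (κ :: ks) u ++ tw (κ :: ks) w = seg κ (p : ℤ) ++ (tw ks u ++ seg κ (q : ℤ)) ++ tw ks w := by
        simp only [tw_cons, hp, hq, List.append_assoc]
      have h2 : tw (κ :: ks) (u + w) = seg κ (p : ℤ) ++ seg κ (q : ℤ) ++ tw ks (u + w) := by
        rw [tw_cons, Pi.add_apply, hp, hq, seg_natCast_add]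
      have hmid : seg κ (p : ℤ) ++ (seg κ (q : ℤ) ++ tw ks u) ++ tw ks w = seg κ (p : ℤ) ++ seg κ (q : ℤ) ++ (tw ks u ++ tw ks w) := by
        simp only [List.append_assoc]
      rw [h1, h2]
      -- step 1: move `seg κ q` left through `tw ks u`
      have hs1 : ‖((hol W x (seg κ (p : ℤ) ++ (tw ks u ++ seg κ (q : ℤ)) ++ tw ks w) : (Matrix n n ℂ)ˣ) : Matrix n n ℂ)
            - ((hol W x (seg κ (p : ℤ) ++ (seg κ (q : ℤ) ++ tw ks u) ++ tw ks w) : (Matrix n n ℂ)ˣ) : Matrix n n ℂ)‖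
          ≤ (q : ℝ) * ((tw ks u).length : ℝ) * a := by
        refine (norm_hol_append3_sub_le hW x _ _ _ _ (by simp only [disp_append]; abel)).trans ?_
        rw [norm_sub_rev, seg_natCast]
        exact norm_hol_replicate_word_comm_le hW ha hWa (tw ks u) hword q _
      -- step 2: the induction hypothesis behind the merged `κ`-segment
      have hs2 : ‖((hol W x (seg κ (p : ℤ) ++ seg κ (q : ℤ) ++ (tw ks u ++ tw ks w)) : (Matrix n n ℂ)ˣ) : Matrix n n ℂ)
            - ((hol W x (seg κ (p : ℤ) ++ seg κ (q : ℤ) ++ tw ks (u + w)) : (Matrix n n ℂ)ˣ) : Matrix n n ℂ)‖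
          ≤ ((tw ks u).length : ℝ) * ((tw ks w).length : ℝ) * a := by
        have h := norm_hol_append3_sub_le hW x (seg κ (p : ℤ) ++ seg κ (q : ℤ)) (tw ks u ++ tw ks w) (tw ks (u + w)) []
          (by rw [disp_append, disp_tw_add])
        simp only [List.append_nil] at h
        exact h.trans (ih hnd' hu hw _)
      rw [← hmid] at hs2
      calc _ ≤ _ + _ := norm_sub_le_norm_sub_add_norm_sub _ _ _
        _ ≤ (q : ℝ) * ((tw ks u).length : ℝ) * a + ((tw ks u).length : ℝ) * ((tw ks w).length : ℝ) * a := add_le_add hs1 hs2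
        _ ≤ ((tw (κ :: ks) u).length : ℝ) * ((tw (κ :: ks) w).length : ℝ) * a := by
            simp only [tw_cons, List.length_append, length_seg, hp, hq, Int.natAbs_natCast]
            push_cast
            have h0 : (0 : ℝ) ≤ (p : ℝ) * ((q : ℝ) + ((tw ks w).length : ℝ)) * a := mul_nonneg (by positivity) ha
            nlinarith [h0]

/-- **MERGING TWO CONSECUTIVE COMB WORDS**: for `V, v ≥ 0`,
`‖W(klast_κ V I from Q)·W(klast_κ v i from Q+V+I•e_κ) − W(klast_κ (V+v) (I+i) from Q)‖ ≤ ((|V|₁ + I)·|v|₁ + |V|₁·|v|₁)·a`: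
the fine transverse tree is carried back through the `κ`-run (a ribbon), then the two transverse trees are merged. [folklore] -/
theorem norm_hol_klast_mul_klast_sub_le (Q : Site d) (κ : Fin d) {V v : Site d} (hV : 0 ≤ V) (hv : 0 ≤ v) (I i : ℕ) :
    ‖((hol W Q (klastWord κ V I) * hol W (Q + V + (I : ℤ) • e κ) (klastWord κ v i) : (Matrix n n ℂ)ˣ) : Matrix n n ℂ)
        - ((hol W Q (klastWord κ (V + v) (I + i)) : (Matrix n n ℂ)ˣ) : Matrix n n ℂ)‖
      ≤ (((l1 V : ℝ) + I) * (l1 v : ℝ) + (l1 V : ℝ) * (l1 v : ℝ)) * a := by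
  obtain ⟨P, hP⟩ := Int.eq_ofNat_of_zero_le (hV κ)
  obtain ⟨p, hp⟩ := Int.eq_ofNat_of_zero_le (hv κ)
  set V' : Site d := V - V κ • e κ with hV'
  set v' : Site d := v - v κ • e κ with hv'
  have hv'ap : ∀ ι, v' ι = if ι = κ then 0 else v ι := sub_coord_apply v κ
  have hV'0 : 0 ≤ V' := sub_coord_nonneg hV κ
  have hv'0 : 0 ≤ v' := sub_coord_nonneg hv κ
  -- the product is the holonomy of the concatenation
  have hprod : hol W Q (klastWord κ V I) * hol W (Q + V + (I : ℤ) • e κ) (klastWord κ v i)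
      = hol W Q (klastWord κ V I ++ klastWord κ v i) := by
    rw [hol_append, disp_klastWord, add_assoc]
  -- the words
  have hw1 : klastWord κ V I ++ klastWord κ v i
      = treeWord V' ++ (seg κ ((P + I : ℕ) : ℤ) ++ treeWord v') ++ seg κ ((p + i : ℕ) : ℤ) := by
    rw [klastWord, klastWord, ← hV', ← hv', hP, hp]; push_cast; simp only [List.append_assoc]
  have hsum : V + v - (V + v) κ • e κ = V' + v' := by
    simp only [hV', hv', Pi.add_apply, add_smul]; abel
  have hexp : (V + v) κ + ((I + i : ℕ) : ℤ) = ((P + I : ℕ) : ℤ) + ((p + i : ℕ) : ℤ) := by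
    simp only [Pi.add_apply, hP, hp]; push_cast; ring
  have hw2 : klastWord κ (V + v) (I + i) = treeWord (V' + v') ++ seg κ (((P + I : ℕ) : ℤ) + ((p + i : ℕ) : ℤ)) := by
    rw [klastWord, hsum, hexp]
  have hmid : treeWord V' ++ (treeWord v' ++ seg κ ((P + I : ℕ) : ℤ)) ++ seg κ ((p + i : ℕ) : ℤ)
      = (treeWord V' ++ treeWord v') ++ seg κ (((P + I : ℕ) : ℤ) + ((p + i : ℕ) : ℤ)) := by
    rw [seg_natCast_add]; simp only [List.append_assoc]
  rw [hprod, hw1, hw2]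
  have hword : ∀ l ∈ treeWord v', l.2 = true ∧ l.1 ≠ κ := fun l hl =>
    ⟨by rw [forward_of_mem_treeWord hv'0 hl], fun h => ne_zero_of_mem_treeWord hl (by rw [h, hv'ap, if_pos rfl])⟩
  -- step 1: the fine transverse tree back through the `κ`-run
  have hs1 : ‖((hol W Q (treeWord V' ++ (seg κ ((P + I : ℕ) : ℤ) ++ treeWord v') ++ seg κ ((p + i : ℕ) : ℤ)) : (Matrix n n ℂ)ˣ) : Matrix n n ℂ)
        - ((hol W Q (treeWord V' ++ (treeWord v' ++ seg κ ((P + I : ℕ) : ℤ)) ++ seg κ ((p + i : ℕ) : ℤ)) : (Matrix n n ℂ)ˣ) : Matrix n n ℂ)‖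
      ≤ ((P + I : ℕ) : ℝ) * (l1 v' : ℝ) * a := by
    refine (norm_hol_append3_sub_le hW Q _ _ _ _ (by simp only [disp_append]; abel)).trans ?_
    rw [seg_natCast, ← length_treeWord v']
    exact norm_hol_replicate_word_comm_le hW ha hWa (treeWord v') hword _ _
  -- step 2: merge the two transverse trees
  have hs2 : ‖((hol W Q ((treeWord V' ++ treeWord v') ++ seg κ (((P + I : ℕ) : ℤ) + ((p + i : ℕ) : ℤ))) : (Matrix n n ℂ)ˣ) : Matrix n n ℂ)
        - ((hol W Q (treeWord (V' + v') ++ seg κ (((P + I : ℕ) : ℤ) + ((p + i : ℕ) : ℤ))) : (Matrix n n ℂ)ˣ) : Matrix n n ℂ)‖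
      ≤ (l1 V' : ℝ) * (l1 v' : ℝ) * a := by
    have h := norm_hol_append3_sub_le hW Q [] (treeWord V' ++ treeWord v') (treeWord (V' + v')) (seg κ (((P + I : ℕ) : ℤ) + ((p + i : ℕ) : ℤ)))
      (by rw [disp_append, disp_treeWord, disp_treeWord, disp_treeWord])
    simp only [List.nil_append, disp_nil, add_zero] at h
    refine h.trans ?_
    have h' := norm_hol_tw_append_sub_le hW ha hWa (List.finRange d).reverse (List.nodup_reverse.mpr (List.nodup_finRange d)) hV'0 hv'0 Q
    rw [← treeWord_eq_tw, ← treeWord_eq_tw, ← treeWord_eq_tw, length_treeWord, length_treeWord] at h'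
    exact h'
  rw [← hmid] at hs2
  have hl1V : (l1 V' : ℝ) ≤ l1 V := by exact_mod_cast (l1_sub_coord V κ).symm ▸ Nat.le_add_right _ _
  have hl1v : (l1 v' : ℝ) ≤ l1 v := by exact_mod_cast (l1_sub_coord v κ).symm ▸ Nat.le_add_right _ _
  have hPI : ((P + I : ℕ) : ℝ) ≤ (l1 V : ℝ) + I := by
    have h := l1_sub_coord V κ
    rw [hP, Int.natAbs_natCast] at h
    push_cast
    have : (P : ℝ) ≤ l1 V := by exact_mod_cast h ▸ Nat.le_add_left _ _
    linarith
  calc _ ≤ _ + _ := norm_sub_le_norm_sub_add_norm_sub _ _ _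
    _ ≤ ((P + I : ℕ) : ℝ) * (l1 v' : ℝ) * a + (l1 V' : ℝ) * (l1 v' : ℝ) * a := add_le_add hs1 hs2
    _ ≤ ((l1 V : ℝ) + I) * (l1 v : ℝ) * a + (l1 V : ℝ) * (l1 v : ℝ) * a := by gcongr
    _ = _ := by ring

end Flat

end

end Summit.QuantumFields.BalabanUV.T4Continuum.NE3CombVsTowerPaths
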